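import Mathlib.MeasureTheory.Measure.Haar.MulEquivHaarChar
import Mathlib.MeasureTheory.Group.FundamentalDomain
import HarnessLib

/-!
# An automorphism preserving a lattice preserves Haar measure
(Raghunathan, *Discrete subgroups of Lie groups* (1972), Ch. I, Remark 1.9; Weil, *Basic Number
Theory*, Ch. II §4, the argument behind the product formula)

Topic `MeasureTheory/Group`; namespace `Literature.MeasureTheory.Group`. Abstract measure theory
(Mathlib only). Let `G` be a locally compact group, `μ` a regular Haar measure, `Γ ≤ G` a countable
subgroup with a measurable fundamental domain `𝓕` (for left multiplication) of finite positive
measure, and `φ : G ≃ₜ* G` a topological automorphism with `φ(Γ) = Γ`. Then **`φ` preserves `μ`**: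
`mulEquivHaarChar φ = 1` (Mathlib's scaling factor of `φ` on Haar measures), i.e. `μ ∘ φ⁻¹ = μ`.

*Proof.* `φ(𝓕)` is again a fundamental domain of `φ(Γ) = Γ` (`IsFundamentalDomain.image_of_equiv`;
`φ⁻¹` quasi-preserves `μ` because it maps `μ` to a multiple of `μ`), so `μ(φ 𝓕) = μ(𝓕)` (all
fundamental domains have the same measure), while `μ(φ 𝓕) = mulEquivHaarChar φ · μ(φ⁻¹ φ 𝓕) =
mulEquivHaarChar φ · μ(𝓕)` (`mulEquivHaarChar_smul_preimage`); cancel the finite positive `μ(𝓕)`.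

This is the measure-theoretic content of the product formula `|ξ|_𝔸 = 1` (`ξ ∈ Kˣ` preserves the
lattice `K ⊂ 𝔸_K`) and of its non-abelian analogues used by the Rankin–Selberg unfolding on
`GL_n(𝔸_K)`: conjugation by a rational matrix normalising a unipotent group `U(𝔸_K)` and its lattice
`U(K)` preserves the Haar measure of `U(𝔸_K)`. The companion statement "a group with a lattice is
unimodular" is `Literature.NumberTheory.Automorphic.isMulRightInvariant_of_isFundamentalDomain`
(`LatticeUnimodular`). No Mathlib statement covers either (`lean search 'mulEquivHaarChar.*undamental'`);
tagged folklore.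

* `quasiMeasurePreserving_continuousMulEquiv` — a topological automorphism quasi-preserves a regular
  Haar measure;
* `isFundamentalDomain_image_continuousMulEquiv` — `φ(𝓕)` is a fundamental domain of `Γ` when
  `φ(Γ) = Γ`;
* `mulEquivHaarChar_eq_one_of_isFundamentalDomain` — the theorem; `map_continuousMulEquiv_eq_self`,
  `lintegral_comp_continuousMulEquiv_eq` — the consequences `map φ μ = μ` and
  `∫ f(φ x) dμ = ∫ f dμ`.
-/

noncomputable section

open _root_.MeasureTheory _root_.MeasureTheory.Measure Set Function
open scoped ENNReal NNReal Pointwise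

namespace Literature.MeasureTheory.Group

variable {G : Type*} [Group G] [TopologicalSpace G] [IsTopologicalGroup G] [LocallyCompactSpace G]
  [MeasurableSpace G] [BorelSpace G] (μ : Measure G) [IsHaarMeasure μ] [μ.Regular]

/-- **A topological automorphism quasi-preserves a regular Haar measure**: `map φ μ` is the multiple
`(mulEquivHaarChar φ)⁻¹ • μ` of `μ` (Mathlib `mulEquivHaarChar_smul_map`), hence absolutely continuous.
[folklore] -/
theorem quasiMeasurePreserving_continuousMulEquiv (φ : G ≃ₜ* G) :
    QuasiMeasurePreserving φ μ μ := by
  refine ⟨φ.continuous.measurable, fun s hs => ?_⟩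
  have h := mulEquivHaarChar_smul_map μ φ
  have hc : (mulEquivHaarChar φ : ℝ≥0∞) ≠ 0 := by
    exact_mod_cast (mulEquivHaarChar_pos φ).ne'
  have h1 : (mulEquivHaarChar φ • μ.map φ) s = 0 := by
    rw [h]
    exact hs
  simp only [Measure.smul_apply, nnreal_smul_coe_apply, mul_eq_zero] at h1
  rcases h1 with h1 | h1
  · exact absurd h1 hc
  · exact h1

/-- **The image of a fundamental domain under a lattice-preserving automorphism.** If `𝓕` is a
fundamental domain for the left multiplication action of a subgroup `Γ` and the topological
automorphism `φ` satisfies `φ(Γ) = Γ`, then `φ(𝓕)` is again a fundamental domain of `Γ` (for the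
regular Haar measure `μ`). [folklore] -/
theorem isFundamentalDomain_image_continuousMulEquiv (Γ : Subgroup G) {𝓕 : Set G}
    (h𝓕 : IsFundamentalDomain Γ 𝓕 μ) (φ : G ≃ₜ* G) (hΓ : ∀ g : G, φ g ∈ Γ ↔ g ∈ Γ) :
    IsFundamentalDomain Γ (φ '' 𝓕) μ := by
  -- the induced bijection of `Γ`: `e γ = φ⁻¹ γ`
  have hsymm : ∀ g : G, φ.symm g ∈ Γ ↔ g ∈ Γ := fun g => by
    rw [← hΓ (φ.symm g), ContinuousMulEquiv.apply_symm_apply]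
  let e : Γ ≃ Γ :=
    { toFun := fun γ => ⟨φ.symm γ, (hsymm γ).2 γ.2⟩
      invFun := fun γ => ⟨φ γ, (hΓ γ).2 γ.2⟩
      left_inv := fun γ => Subtype.ext (φ.apply_symm_apply γ)
      right_inv := fun γ => Subtype.ext (φ.symm_apply_apply γ) }
  refine h𝓕.image_of_equiv (φ : G ≃ G) ?_ e fun γ x => ?_
  · -- `φ⁻¹` quasi-preserves `μ`
    have hq := quasiMeasurePreserving_continuousMulEquiv μ φ.symm
    exact hq
  · -- `φ (e γ • x) = γ • φ x`
    change φ ((φ.symm (γ : G)) * x) = (γ : G) * φ x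
    rw [map_mul, ContinuousMulEquiv.apply_symm_apply]

/-- **An automorphism preserving a lattice preserves Haar measure.** Let `μ` be a regular Haar measure
on the locally compact group `G`, `Γ ≤ G` a countable subgroup with a measurable fundamental domain
`𝓕` of finite positive measure, and `φ : G ≃ₜ* G` a topological automorphism with `φ(Γ) = Γ`. Then
`mulEquivHaarChar φ = 1`: both `𝓕` and `φ(𝓕)` are fundamental domains of `Γ`, so they have the same
measure, while `μ(φ 𝓕) = mulEquivHaarChar φ · μ(𝓕)` (Raghunathan (1972), I, Remark 1.9; the
measure-theoretic product formula). [folklore] -/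
theorem mulEquivHaarChar_eq_one_of_isFundamentalDomain (Γ : Subgroup G) [Countable Γ] {𝓕 : Set G}
    (h𝓕 : IsFundamentalDomain Γ 𝓕 μ) (h0 : μ 𝓕 ≠ 0) (htop : μ 𝓕 ≠ ∞) (φ : G ≃ₜ* G)
    (hΓ : ∀ g : G, φ g ∈ Γ ↔ g ∈ Γ) : mulEquivHaarChar φ = 1 := by
  have h1 : μ (φ '' 𝓕) = μ 𝓕 :=
    (isFundamentalDomain_image_continuousMulEquiv μ Γ h𝓕 φ hΓ).measure_eq h𝓕
  have h2 : (mulEquivHaarChar φ : ℝ≥0∞) * μ 𝓕 = μ (φ '' 𝓕) := by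
    have h := mulEquivHaarChar_smul_preimage μ (X := φ '' 𝓕) φ
    rw [Set.preimage_image_eq 𝓕 φ.injective] at h
    rw [← h]
    rfl
  rw [h1] at h2
  have h3 : (mulEquivHaarChar φ : ℝ≥0∞) = 1 := by
    have := (ENNReal.mul_left_inj h0 htop).1 (h2.trans (one_mul _).symm)
    exact this
  exact_mod_cast h3

/-- Hence **`φ` preserves `μ`**: `map φ μ = μ`. [folklore] -/
theorem map_continuousMulEquiv_eq_self (Γ : Subgroup G) [Countable Γ] {𝓕 : Set G}
    (h𝓕 : IsFundamentalDomain Γ 𝓕 μ) (h0 : μ 𝓕 ≠ 0) (htop : μ 𝓕 ≠ ∞) (φ : G ≃ₜ* G)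
    (hΓ : ∀ g : G, φ g ∈ Γ ↔ g ∈ Γ) : μ.map φ = μ := by
  have h := mulEquivHaarChar_smul_map μ φ
  rw [mulEquivHaarChar_eq_one_of_isFundamentalDomain μ Γ h𝓕 h0 htop φ hΓ, one_smul] at h
  exact h

/-- Hence the **change of variables** `∫ f(φ x) dμ = ∫ f dμ` for measurable `f ≥ 0`. [folklore] -/
theorem lintegral_comp_continuousMulEquiv_eq (Γ : Subgroup G) [Countable Γ] {𝓕 : Set G}
    (h𝓕 : IsFundamentalDomain Γ 𝓕 μ) (h0 : μ 𝓕 ≠ 0) (htop : μ 𝓕 ≠ ∞) (φ : G ≃ₜ* G)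
    (hΓ : ∀ g : G, φ g ∈ Γ ↔ g ∈ Γ) {f : G → ℝ≥0∞} (hf : Measurable f) :
    ∫⁻ x, f (φ x) ∂μ = ∫⁻ x, f x ∂μ := by
  have hmp : MeasurePreserving φ μ μ :=
    ⟨φ.continuous.measurable, map_continuousMulEquiv_eq_self μ Γ h𝓕 h0 htop φ hΓ⟩
  exact hmp.lintegral_comp hf

/-- The same for the Bochner integral of any function (no measurability needed:
`MeasurePreserving.integral_comp'`). [folklore] -/
theorem integral_comp_continuousMulEquiv_eq (Γ : Subgroup G) [Countable Γ] {𝓕 : Set G}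
    (h𝓕 : IsFundamentalDomain Γ 𝓕 μ) (h0 : μ 𝓕 ≠ 0) (htop : μ 𝓕 ≠ ∞) (φ : G ≃ₜ* G)
    (hΓ : ∀ g : G, φ g ∈ Γ ↔ g ∈ Γ) {E : Type*} [NormedAddCommGroup E] [NormedSpace ℝ E]
    (f : G → E) : ∫ x, f (φ x) ∂μ = ∫ x, f x ∂μ := by
  have hmp : MeasurePreserving φ μ μ :=
    ⟨φ.continuous.measurable, map_continuousMulEquiv_eq_self μ Γ h𝓕 h0 htop φ hΓ⟩
  exact hmp.integral_comp' (f := φ.toHomeomorph.toMeasurableEquiv) f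

end Literature.MeasureTheory.Group
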